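import Summits.QuantumFields.YangMills.Theorems.FluctuationComparisonRegPrIntLS2BetaWeightedTwoProfileTowerSum
import Mathlib.Analysis.SpecialFunctions.Exp
import HarnessLib

/-!
# S2β · (RSP) ENGINE — THE SQUARE SUM OF A CONTRACTING SUP LADDER: from `s_{j+1} ≤ a·s_j + σ_j`, `(1+κ)a² < 1`,
# `Σ_{j<n} s_j² ≤ (s_0² + (1+κ⁻¹)·Σ_{j<n} σ_j²) ∕ (1 − (1+κ)a²)`; the (RSP) reading with `s_0 ≤ π`, `a = c_•∕L`, `κ = 1∕5`; and the packaging
# `Σ θ_j² ≤ Θ·Σθ_j ≤ Θ·e^{Σθ}` of the window term (lattice-free real algebra)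

Cell `ym3-torus` (rung R3 = continuum `SU(2)` Yang–Mills on the three-torus — NOT d = 4, NOT infinite volume, NOT a mass gap, NOT Clay).
Width seat «width 21» `ym3-torus-px21` (gen 24); `--kind proof --supports stmt-QuantumFields-20520 --as helper`, count-neutral, DEFINITION-FREE
(0 `def`, 0 `instance`, 0 `notation`, 0 `sorry`, default heartbeats); LATTICE-FREE (real sequences only).

WHY (architect RULING 19:27:44Z «SRC-q»: the quadratic chart remainder is priced as (a-priori SUP)² × energy, so the gap list gains (RSP) = «`∀ j, ‖chord_j‖ ≤ s_j` ∧
`Σ_j s_j² ≤ C_s(L)·e^{c_sΣθ}` N-FREE», discharged by the GLOBAL-SUP LADDER `s_{j+1} ≤ (c_•∕L)·s_j + C·L²·(2θ-window)` with the fibre-free start `s ≤ π`;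
holder of the letter + tower discharge: px12 g26 (RULING 19:37:59Z); THIS FILE is the lattice-free engine its discharge ends with, px21 g24 19:38:31Z).
* §1 ★★★ `sq_sum_le_of_sup_ladder` — `0 ≤ s j`, `s (j+1) ≤ a·s j + σ j`, `0 ≤ a`, `0 < κ`, `(1+κ)·a² < 1` ⟹ for every `n`,
  `Σ_{j<n} (s j)² ≤ ((s 0)² + (1+κ⁻¹)·Σ_{j<n} (σ j)²) ∕ (1 − (1+κ)·a²)` (Young's squaring ✓p829914 `sq_le_of_le_mul_add`, then ✓`weighted_tower_sum_le` at weight `1`).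
* §2 ★★ `sq_sum_le_of_sup_ladder_pi` — the (RSP) reading: `s 0 ≤ π`, `a = c∕L`, `κ = 1∕5` (`1 + κ⁻¹ = 6`): `Σ_{j<n} s_j² ≤ (π² + 6·Σ_{j<n} σ_j²) ∕ (1 − (6∕5)·(c∕L)²)`.
* §3 ★ `sum_sq_le_sup_mul_sum` (`0 ≤ θ j ≤ Θ` ⟹ `Σ θ_j² ≤ Θ·Σ θ_j`), `mul_sum_le_mul_exp` (`0 ≤ Θ` ⟹ `Θ·Σθ ≤ Θ·e^{Σθ}` for `Σθ ≥ 0`), and the packaged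
  ★★ `sq_sum_le_exp_of_sup_ladder_window` — with `σ j = C·(θ j)`, `0 ≤ θ j ≤ Θ`: `Σ_{j<n} s_j² ≤ (π² + 6C²Θ·e^{Σ_{j<n}θ_j}) ∕ (1 − (6∕5)(c∕L)²)` —
  the `C_s(L)·e^{c_sΣθ}` shape of the ruling (`c_s = 1`; any `c_s > 0` by rescaling `θ`).

HONEST SCOPE.  Real algebra; nothing of Bałaban's analysis is asserted or proved; (RSP)'s letter and its tower discharge (the per-level sup step for comb ∕ face ∕ nc bonds of the
two `AxStage` towers), (S-SRC), (BKG), LIFT-LADDER's rows, (ST″)'s discharge, LOC″, D-GUARD, GAP♯∘ (`stub_uniformFibreGapOrbit`, registry untouched, 0∕5), S2β, crux 20520 and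
`YM3TorusSU2` are NOT proved; no registered stub is closed; rung R3 = SU(2) YM₃ on T³ — NOT d = 4, NOT infinite volume, NOT a mass gap, NOT Clay; the Yang–Mills mass gap is NOT proved.
References: T. Bałaban, CMP **109** (1987) 249–301 [Balaban1987RG1] ((0.4) p.252, the scale recursion bookkeeping); CMP **102** (1985) 277–309 [Balaban1985UV3] ((25) p.262, (26)–(27) p.263,
the small-field windows); CMP **99** (1985) 75–102 [Balaban1985RegularSpaces] ((1.29) p.81).
-/

set_option autoImplicit false

namespace Summit.QuantumFields.YangMills.Theorems.FluctuationComparisonRegPrIntLS2BetaSupLadderSquareSum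

open Finset
open Summit.QuantumFields.YangMills.Theorems.FluctuationComparisonRegPrIntLS2BetaWeightedTwoProfileTowerSum (sq_le_of_le_mul_add weighted_tower_sum_le)

/-! ## §1 The square sum of a contracting sup ladder -/

/-- ★★★ **SQUARE SUM OF A CONTRACTING SUP LADDER**: `0 ≤ s j`, `s (j+1) ≤ a·s j + σ j`, `0 ≤ a`, `0 < κ`, `(1+κ)a² < 1` ⟹
`Σ_{j<n} (s j)² ≤ ((s 0)² + (1+κ⁻¹)·Σ_{j<n} (σ j)²) ∕ (1 − (1+κ)a²)`. [cite: Balaban1987RG1, (0.4) p.252 (bookkeeping)] -/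
theorem sq_sum_le_of_sup_ladder (s σ : ℕ → ℝ) {a κ : ℝ} (hs0 : ∀ j, 0 ≤ s j) (ha : 0 ≤ a) (hκ : 0 < κ) (hq : (1 + κ) * a ^ 2 < 1)
    (hstep : ∀ j, s (j + 1) ≤ a * s j + σ j) (n : ℕ) :
    ∑ j ∈ range n, s j ^ 2 ≤ (s 0 ^ 2 + (1 + κ⁻¹) * ∑ j ∈ range n, σ j ^ 2) / (1 - (1 + κ) * a ^ 2) := by
  -- the squared step: `s (j+1)² ≤ (1+κ)a²·s j² + (1+κ⁻¹)·σ j²`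
  have hsq : ∀ j, s (j + 1) ^ 2 ≤ ((1 + κ) * a ^ 2) * s j ^ 2 + (1 + κ⁻¹) * σ j ^ 2 := by
    intro j
    have h := sq_le_of_le_mul_add (hs0 (j + 1)) ha (hs0 j) hκ (hstep j)
    linarith
  -- one-profile weighted sum at weight `L = 1` with sources `S t := (1+κ⁻¹)·σ (t-1)²` (`S 0 := 0`)
  have hκ' : 0 ≤ 1 + κ⁻¹ := by positivity
  have h := weighted_tower_sum_le (fun j => s j ^ 2) (fun t => if t = 0 then 0 else (1 + κ⁻¹) * σ (t - 1) ^ 2)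
    (q := (1 + κ) * a ^ 2) (L := 1) (fun t => by positivity)
    (fun t => by split_ifs <;> [exact le_rfl; exact mul_nonneg hκ' (sq_nonneg _)]) (by positivity) zero_le_one (by linarith)
    (fun t => by simp only [Nat.succ_ne_zero, if_false, Nat.add_sub_cancel]; exact hsq t) n
  simp only [one_pow, one_mul] at h
  refine h.trans (div_le_div_of_nonneg_right ?_ (by linarith))
  -- `Σ_{t<n} S t ≤ (1+κ⁻¹)·Σ_{j<n} σ j²` (shift the index; drop the last term)
  have hshift : ∑ t ∈ range n, (if t = 0 then (0 : ℝ) else (1 + κ⁻¹) * σ (t - 1) ^ 2) ≤ (1 + κ⁻¹) * ∑ j ∈ range n, σ j ^ 2 := by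
    rcases n with _ | m
    · simp
    · rw [sum_range_succ', sum_range_succ, mul_add]
      simp only [Nat.succ_ne_zero, if_false, Nat.add_sub_cancel, if_true, add_zero, ← mul_sum]
      nlinarith [mul_nonneg hκ' (sq_nonneg (σ m))]
  linarith

/-! ## §2 The (RSP) reading -/

/-- ★★ **THE (RSP) READING**: start `s 0 ≤ π` (fibre-free), `a = c∕L`, `κ = 1∕5`:
`Σ_{j<n} s_j² ≤ (π² + 6·Σ_{j<n} σ_j²) ∕ (1 − (6∕5)·(c∕L)²)` whenever `(6∕5)(c∕L)² < 1`. [cite: Balaban1987RG1, (0.4) p.252 (bookkeeping); Balaban1985UV3, (25) p.262, (26)-(27) p.263] -/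
theorem sq_sum_le_of_sup_ladder_pi (s σ : ℕ → ℝ) {c L : ℝ} (hs0 : ∀ j, 0 ≤ s j) (hc : 0 ≤ c) (hL : 0 < L)
    (hq : (6 / 5) * (c / L) ^ 2 < 1) (hstart : s 0 ≤ Real.pi) (hstep : ∀ j, s (j + 1) ≤ (c / L) * s j + σ j) (n : ℕ) :
    ∑ j ∈ range n, s j ^ 2 ≤ (Real.pi ^ 2 + 6 * ∑ j ∈ range n, σ j ^ 2) / (1 - (6 / 5) * (c / L) ^ 2) := by
  have h := sq_sum_le_of_sup_ladder s σ hs0 (div_nonneg hc hL.le) (by norm_num : (0 : ℝ) < 1 / 5)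
    (by norm_num; linarith) hstep n
  have h15 : (1 + (1 / 5 : ℝ)) = 6 / 5 := by norm_num
  have h6 : (1 + (1 / 5 : ℝ)⁻¹) = 6 := by norm_num
  rw [h15, h6] at h
  refine h.trans (div_le_div_of_nonneg_right ?_ (by linarith))
  have hπ : s 0 ^ 2 ≤ Real.pi ^ 2 := pow_le_pow_left₀ (hs0 0) hstart 2
  linarith

/-! ## §3 Packaging the window term as `C_s·e^{Σθ}` -/

/-- `0 ≤ θ j ≤ Θ` ⟹ `Σ_{j<n} θ_j² ≤ Θ·Σ_{j<n} θ_j`. [folklore] -/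
theorem sum_sq_le_sup_mul_sum (θ : ℕ → ℝ) {Θ : ℝ} (h0 : ∀ j, 0 ≤ θ j) (hΘ : ∀ j, θ j ≤ Θ) (n : ℕ) :
    ∑ j ∈ range n, θ j ^ 2 ≤ Θ * ∑ j ∈ range n, θ j := by
  rw [mul_sum]
  refine sum_le_sum (fun j _ => ?_)
  rw [sq]
  exact mul_le_mul_of_nonneg_right (hΘ j) (h0 j)

/-- `0 ≤ x` ⟹ `x ≤ e^x` packaged with a nonnegative factor: `Θ·x ≤ Θ·e^x`. [folklore] -/
theorem mul_le_mul_exp {Θ x : ℝ} (hΘ : 0 ≤ Θ) : Θ * x ≤ Θ * Real.exp x :=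
  mul_le_mul_of_nonneg_left (by linarith [Real.add_one_le_exp x]) hΘ

/-- ★★ **(RSP) WITH THE WINDOW SOURCES**: `σ j = C·θ j`, `0 ≤ θ j ≤ Θ`, start `s 0 ≤ π`, `a = c∕L`, `(6∕5)(c∕L)² < 1` ⟹
`Σ_{j<n} s_j² ≤ (π² + 6·C²·Θ·e^{Σ_{j<n} θ_j}) ∕ (1 − (6∕5)(c∕L)²)` — N-free, of the ruled shape `C_s(L)·e^{c_sΣθ}`.
[cite: Balaban1985UV3, (25) p.262, (26)-(27) p.263; Balaban1987RG1, (0.4) p.252 (bookkeeping)] -/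
theorem sq_sum_le_exp_of_sup_ladder_window (s θ : ℕ → ℝ) {c L C Θ : ℝ} (hs0 : ∀ j, 0 ≤ s j) (hc : 0 ≤ c) (hL : 0 < L)
    (hq : (6 / 5) * (c / L) ^ 2 < 1) (hstart : s 0 ≤ Real.pi) (h0 : ∀ j, 0 ≤ θ j) (hΘ : ∀ j, θ j ≤ Θ)
    (hstep : ∀ j, s (j + 1) ≤ (c / L) * s j + C * θ j) (n : ℕ) :
    ∑ j ∈ range n, s j ^ 2 ≤ (Real.pi ^ 2 + 6 * C ^ 2 * Θ * Real.exp (∑ j ∈ range n, θ j)) / (1 - (6 / 5) * (c / L) ^ 2) := by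
  have h := sq_sum_le_of_sup_ladder_pi s (fun j => C * θ j) hs0 hc hL hq hstart hstep n
  refine h.trans (div_le_div_of_nonneg_right ?_ (by linarith))
  have hΘ0 : 0 ≤ Θ := (h0 0).trans (hΘ 0)
  have h1 : ∑ j ∈ range n, (C * θ j) ^ 2 = C ^ 2 * ∑ j ∈ range n, θ j ^ 2 := by
    rw [mul_sum]; exact sum_congr rfl (fun j _ => by ring)
  have h2 := sum_sq_le_sup_mul_sum θ h0 hΘ n
  have h3 : Θ * ∑ j ∈ range n, θ j ≤ Θ * Real.exp (∑ j ∈ range n, θ j) := mul_le_mul_exp hΘ0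
  have hC2 : 0 ≤ C ^ 2 := sq_nonneg C
  rw [h1]
  nlinarith [mul_le_mul_of_nonneg_left (h2.trans h3) hC2]

/-! ## §4 The linear edition (architect RULING 19:55:50Z: (RSP) as SUP-SUMMABILITY `Σ_j s_j`, for the exponent) -/

/-- ★★★ **SUM OF A CONTRACTING SUP LADDER (linear edition)**: `0 ≤ s j`, `0 ≤ σ j`, `s (j+1) ≤ a·s j + σ j`, `0 ≤ a < 1` ⟹
`Σ_{j<n} s j ≤ (s 0 + Σ_{j<n} σ j) ∕ (1 − a)`. [cite: Balaban1987RG1, (0.4) p.252 (bookkeeping)] -/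
theorem sum_le_of_sup_ladder (s σ : ℕ → ℝ) {a : ℝ} (hs0 : ∀ j, 0 ≤ s j) (hσ0 : ∀ j, 0 ≤ σ j) (ha : 0 ≤ a) (ha1 : a < 1)
    (hstep : ∀ j, s (j + 1) ≤ a * s j + σ j) (n : ℕ) :
    ∑ j ∈ range n, s j ≤ (s 0 + ∑ j ∈ range n, σ j) / (1 - a) := by
  have h := weighted_tower_sum_le s (fun t => if t = 0 then 0 else σ (t - 1)) (q := a) (L := 1) hs0
    (fun t => by split_ifs <;> [exact le_rfl; exact hσ0 _]) ha zero_le_one (by linarith)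
    (fun t => by simp only [Nat.succ_ne_zero, if_false, Nat.add_sub_cancel]; exact hstep t) n
  simp only [one_pow, one_mul] at h
  refine h.trans (div_le_div_of_nonneg_right ?_ (by linarith))
  have hshift : ∑ t ∈ range n, (if t = 0 then (0 : ℝ) else σ (t - 1)) ≤ ∑ j ∈ range n, σ j := by
    rcases n with _ | m
    · simp
    · rw [sum_range_succ', sum_range_succ]
      simp only [Nat.succ_ne_zero, if_false, Nat.add_sub_cancel, if_true, add_zero]
      linarith [hσ0 m]
  linarith

/-- ★★ **THE LINEAR (RSP) READING WITH THE WINDOW SOURCES**: `s 0 ≤ π`, `a = c∕L` (`0 ≤ c < L`), `σ j = C·θ j` (`0 ≤ C`, `0 ≤ θ j`) ⟹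
`Σ_{j<n} s_j ≤ (π + C·Σ_{j<n} θ_j) ∕ (1 − c∕L)` — N-free; with `x ≤ e^x` on the right if an exponential shape is wanted.
[cite: Balaban1985UV3, (25) p.262, (26)-(27) p.263; Balaban1987RG1, (0.4) p.252 (bookkeeping)] -/
theorem sum_le_of_sup_ladder_window (s θ : ℕ → ℝ) {c L C : ℝ} (hs0 : ∀ j, 0 ≤ s j) (hc : 0 ≤ c) (hL : 0 < L) (hcL : c < L)
    (hstart : s 0 ≤ Real.pi) (hC : 0 ≤ C) (h0 : ∀ j, 0 ≤ θ j) (hstep : ∀ j, s (j + 1) ≤ (c / L) * s j + C * θ j) (n : ℕ) :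
    ∑ j ∈ range n, s j ≤ (Real.pi + C * ∑ j ∈ range n, θ j) / (1 - c / L) := by
  have ha1 : c / L < 1 := (div_lt_one hL).mpr hcL
  have h := sum_le_of_sup_ladder s (fun j => C * θ j) hs0 (fun j => mul_nonneg hC (h0 j)) (div_nonneg hc hL.le) ha1 hstep n
  refine h.trans (div_le_div_of_nonneg_right ?_ (by linarith))
  rw [← mul_sum]
  linarith

end Summit.QuantumFields.YangMills.Theorems.FluctuationComparisonRegPrIntLS2BetaSupLadderSquareSum
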